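import Summits.CriticalPhenomena.PercolationContinuityZ3.Theorems.SahiBoxTP2TiltHilbert
import Summits.CriticalPhenomena.PercolationContinuityZ3.Theorems.SahiBoxTP2Real
import Summits.CriticalPhenomena.PercolationContinuityZ3.Theorems.SahiBoxTP2Transport

/-!
# Box-TP₂ on `ℝ^d` is preserved by bounded continuous log-supermodular tilts

Support file of the Sahi cell (`prim-sahi`, typer seat, generation 14; `--supports stmt-CriticalPhenomena-4575`).
Theorems only (no definitions, no named facts, no sorries).  The `ℝ^d` companion of `SahiBoxTP2Tilt.lean` (unit
cube) and `SahiBoxTP2TiltHilbert.lean` (Hilbert cube): the natural home of lattice fields / `φ⁴`-type measures and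
of Gaussians.

* `isBoxTP2_of_map_sigmoidPi` — converse of generation 11's `IsBoxTP2.map_sigmoidPi`: a measure on `ℝ^d` whose
  image under the coordinatewise sigmoid is box-TP₂ on `Q_d` is box-TP₂ (`sigmoidPi` is a lattice embedding onto the
  open cube).
* `IsBoxTP2.withDensity_clamp_real` — for a finite box-TP₂ measure `ν` on `ℝ^d` and a continuous log-supermodular
  `ρ`, the truncated tilt `ρ(clamp_R x) · ν` is box-TP₂: transported to `Q_d` it is the tilt of `ν.map sigmoidPi` by the
  CONTINUOUS log-supermodular `ρ ∘ logit ∘ (clamp into [σ(−R), σ(R)]^d)`, to which the cube theorem applies.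
* `IsBoxTP2.withDensity_of_continuous_real` — for `ρ` moreover BOUNDED, `ρ · ν` is box-TP₂ (the truncated tilts
  converge setwise as `R → ∞`; abstract closure lemma `IsBoxTP2.of_limsup_liminf`).
* `IsBoxTP2.withDensity_exp_of_submodular_real` — Gibbs modifications `e^{−H} ν` with `H` continuous, submodular and
  bounded below; with `SahiBoxTP2Real.lean`: Sahi positivity of order `n` given `L(d,n)` for bounded measurable
  monotone families, FKG unconditionally.
* `IsBoxTP2.withDensity_of_continuous_real_of_lintegral_ne_top` (appended) — UNBOUNDED continuous log-supermodular
  `ρ` with `∫ ρ dν < ∞` (restriction to the cubes `[−R,R]^d`, increasing setwise limit);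
  `IsBoxTP2.withDensity_exp_of_submodular_real_of_lintegral_ne_top` — `e^{−H} ν` with integrable Boltzmann factor.

No sorries, no new axioms.
-/

noncomputable section

namespace Summit.CriticalPhenomena.PercolationContinuityZ3.Theorems.SahiBoxTP2

open MeasureTheory Set Filter Topology Function Literature.Combinatorics.Sahi2008
open scoped ENNReal NNReal unitInterval

variable {d : ℕ}

/-! ### The coordinatewise sigmoid is a lattice embedding -/

/-- The sigmoid `ℝ → [0,1]` is monotone. [folklore] -/
theorem sigmoid_monotone : Monotone unitInterval.sigmoid := fun _ _ h => unitInterval.sigmoid_le_iff.2 h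

/-- `sigmoidPi (x ⊓ y) = sigmoidPi x ⊓ sigmoidPi y`. [folklore] -/
theorem sigmoidPi_inf (x y : Fin d → ℝ) : sigmoidPi (x ⊓ y) = sigmoidPi x ⊓ sigmoidPi y :=
  funext fun j => by simp only [sigmoidPi, Pi.inf_apply]; exact sigmoid_monotone.map_min

/-- `sigmoidPi (x ⊔ y) = sigmoidPi x ⊔ sigmoidPi y`. [folklore] -/
theorem sigmoidPi_sup (x y : Fin d → ℝ) : sigmoidPi (x ⊔ y) = sigmoidPi x ⊔ sigmoidPi y :=
  funext fun j => by simp only [sigmoidPi, Pi.sup_apply]; exact sigmoid_monotone.map_max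

/-- Boxes of `ℝ^d` are the preimages of the boxes of their sigmoid corners. [folklore] -/
theorem map_sigmoidPi_Icc (ν : Measure (Fin d → ℝ)) (x y : Fin d → ℝ) :
    ν.map sigmoidPi (Icc (sigmoidPi x) (sigmoidPi y)) = ν (Icc x y) := by
  rw [Measure.map_apply measurable_sigmoidPi measurableSet_Icc,
    sigmoidPi_preimage_Icc (sigmoidPi_mem_openCube x) (sigmoidPi_mem_openCube y), logitPi_sigmoidPi,
    logitPi_sigmoidPi]

/-- **A measure on `ℝ^d` whose sigmoid image is box-TP₂ on `Q_d` is box-TP₂** (converse of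
`IsBoxTP2.map_sigmoidPi`). [this work] -/
theorem isBoxTP2_of_map_sigmoidPi (ν : Measure (Fin d → ℝ)) (h : IsBoxTP2 (ν.map sigmoidPi)) : IsBoxTP2 ν := by
  intro a b a' b'
  have key := h (sigmoidPi a) (sigmoidPi b) (sigmoidPi a') (sigmoidPi b')
  rw [← sigmoidPi_inf, ← sigmoidPi_inf, ← sigmoidPi_sup, ← sigmoidPi_sup, map_sigmoidPi_Icc, map_sigmoidPi_Icc,
    map_sigmoidPi_Icc, map_sigmoidPi_Icc] at key
  exact key

/-! ### Clamping and the continuous logit of the clamped cube -/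

/-- The logit is continuous on the open interval. [folklore] -/
theorem continuousOn_logit : ContinuousOn logit {v : I | (v : ℝ) ∈ Ioo 0 1} := by
  have h1 : ContinuousOn (fun v : I => (v : ℝ) / (1 - v)) {v : I | (v : ℝ) ∈ Ioo 0 1} :=
    continuous_subtype_val.continuousOn.div (continuous_const.sub continuous_subtype_val).continuousOn
      fun v hv => (sub_pos.2 hv.2).ne'
  exact h1.log fun v hv => (div_pos hv.1 (sub_pos.2 hv.2)).ne'

/-- Clamping `[0,1]` into `[σ(−R), σ(R)]`: `v ↦ σ(−R) ⊔ (v ⊓ σ(R))`; its values lie in the open interval.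
[folklore] -/
theorem clampI_mem_Ioo (R : ℝ) (v : I) :
    ((max (unitInterval.sigmoid (-R)) (min v (unitInterval.sigmoid R)) : I) : ℝ) ∈ Ioo 0 1 := by
  constructor
  · exact lt_of_lt_of_le (unitInterval.sigmoid_pos (-R))
      (Subtype.coe_le_coe.2 (le_max_left (unitInterval.sigmoid (-R)) (min v (unitInterval.sigmoid R))))
  · refine lt_of_le_of_lt (Subtype.coe_le_coe.2 (max_le_max (le_refl (unitInterval.sigmoid (-R)))
      (min_le_right v (unitInterval.sigmoid R)))) ?_
    rcases le_total (unitInterval.sigmoid (-R)) (unitInterval.sigmoid R) with h | h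
    · rw [max_eq_right h]; exact unitInterval.sigmoid_lt_one R
    · rw [max_eq_left h]; exact unitInterval.sigmoid_lt_one (-R)

/-- The clamped logit `v ↦ logit (σ(−R) ⊔ (v ⊓ σ R))` is continuous on `[0,1]`. [folklore] -/
theorem continuous_logit_clampI (R : ℝ) :
    Continuous fun v : I => logit (max (unitInterval.sigmoid (-R)) (min v (unitInterval.sigmoid R))) :=
  continuousOn_logit.comp_continuous (continuous_const.max (continuous_id.min continuous_const))
    fun v => clampI_mem_Ioo R v

/-- The clamped logit is monotone on `[0,1]`. [folklore] -/
theorem monotone_logit_clampI (R : ℝ) :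
    Monotone fun v : I => logit (max (unitInterval.sigmoid (-R)) (min v (unitInterval.sigmoid R))) :=
  fun _ _ hvw => logit_le_logit (clampI_mem_Ioo R _) (clampI_mem_Ioo R _)
    (max_le_max le_rfl (min_le_min_right _ hvw))

/-- **The clamped logit of the sigmoid is the clamp**: `logit (σ(−R) ⊔ (σ t ⊓ σ R)) = (−R) ⊔ (t ⊓ R)`. [folklore] -/
theorem logit_clampI_sigmoid (R t : ℝ) :
    logit (max (unitInterval.sigmoid (-R)) (min (unitInterval.sigmoid t) (unitInterval.sigmoid R))) =
      max (-R) (min t R) := by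
  rw [← sigmoid_monotone.map_min, ← sigmoid_monotone.map_max, logit_sigmoid]

/-! ### Truncated tilts -/

/-- **Truncated tilts of box-TP₂ laws on `ℝ^d` are box-TP₂**: for a finite box-TP₂ measure `ν` on `ℝ^d` and a
continuous log-supermodular `ρ : ℝ^d → ℝ≥0`, the measure `ρ((−R) ∨ (x ∧ R)) · ν` (density clamped to the box
`[−R,R]^d`) is box-TP₂. [this work] -/
theorem IsBoxTP2.withDensity_clamp_real (ν : Measure (Fin d → ℝ)) [IsFiniteMeasure ν] (hν : IsBoxTP2 ν)
    {ρ : (Fin d → ℝ) → ℝ≥0} (hρc : Continuous ρ) (hρ : ∀ x y, ρ x * ρ y ≤ ρ (x ⊓ y) * ρ (x ⊔ y)) (R : ℝ) :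
    IsBoxTP2 (ν.withDensity fun x => (ρ (fun j => max (-R) (min (x j) R)) : ℝ≥0∞)) := by
  -- the clamped logit `L : Q_d → ℝ^d` and the transported density `ρ ∘ L`
  set L : (Fin d → I) → (Fin d → ℝ) :=
    fun u j => logit (max (unitInterval.sigmoid (-R)) (min (u j) (unitInterval.sigmoid R))) with hL
  have hLc : Continuous L := continuous_pi fun j => (continuous_logit_clampI R).comp (continuous_apply j)
  have hLinf : ∀ u v, L (u ⊓ v) = L u ⊓ L v := fun u v => funext fun j => by
    simp only [hL, Pi.inf_apply]; exact (monotone_logit_clampI R).map_min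
  have hLsup : ∀ u v, L (u ⊔ v) = L u ⊔ L v := fun u v => funext fun j => by
    simp only [hL, Pi.sup_apply]; exact (monotone_logit_clampI R).map_max
  have hfac : (fun x : Fin d → ℝ => (ρ (fun j => max (-R) (min (x j) R)) : ℝ≥0∞)) =
      (fun u => (ρ (L u) : ℝ≥0∞)) ∘ sigmoidPi := by
    funext x
    simp only [Function.comp_apply, hL, sigmoidPi, logit_clampI_sigmoid]
  have hgm : Measurable fun u : Fin d → I => (ρ (L u) : ℝ≥0∞) :=
    (ENNReal.continuous_coe.comp (hρc.comp hLc)).measurable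
  apply isBoxTP2_of_map_sigmoidPi
  rw [hfac, map_withDensity_comp ν measurable_sigmoidPi hgm]
  exact (hν.map_sigmoidPi ν).withDensity_of_continuous (ν.map sigmoidPi) (ρ := fun u => ρ (L u)) (hρc.comp hLc)
    fun u v => by rw [hLinf, hLsup]; exact hρ _ _

/-- The clamp `(−R) ∨ (x ∧ R) → x` as `R → ∞` (eventually constant in each coordinate). [folklore] -/
theorem tendsto_clamp_real (x : Fin d → ℝ) :
    Tendsto (fun R : ℕ => fun j => max (-(R : ℝ)) (min (x j) R)) atTop (𝓝 x) := by
  rw [tendsto_pi_nhds]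
  intro j
  refine tendsto_atTop_of_eventually_const (i₀ := ⌈|x j|⌉₊) fun R hR => ?_
  have h : |x j| ≤ R := (Nat.le_ceil _).trans (by exact_mod_cast hR)
  rw [min_eq_left (le_of_abs_le h), max_eq_right (neg_le_of_abs_le h)]

/-- **Box-TP₂ on `ℝ^d` is preserved by bounded continuous log-supermodular tilts**: for a finite box-TP₂ measure `ν`
on `ℝ^d` (possibly singular) and `ρ : ℝ^d → ℝ≥0` continuous, bounded, with `ρ x · ρ y ≤ ρ (x ⊓ y) · ρ (x ⊔ y)`, the
tilted measure `ρ · ν` is box-TP₂. [this work] -/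
theorem IsBoxTP2.withDensity_of_continuous_real (ν : Measure (Fin d → ℝ)) [IsFiniteMeasure ν] (hν : IsBoxTP2 ν)
    {ρ : (Fin d → ℝ) → ℝ≥0} (hρc : Continuous ρ) {C : ℝ≥0} (hρC : ∀ x, ρ x ≤ C)
    (hρ : ∀ x y, ρ x * ρ y ≤ ρ (x ⊓ y) * ρ (x ⊔ y)) : IsBoxTP2 (ν.withDensity fun x => (ρ x : ℝ≥0∞)) := by
  haveI : IsFiniteMeasure (ν.withDensity fun x => (ρ x : ℝ≥0∞)) := by
    refine isFiniteMeasure_withDensity (ne_of_lt ?_)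
    calc ∫⁻ x, (ρ x : ℝ≥0∞) ∂ν ≤ ∫⁻ _, (C : ℝ≥0∞) ∂ν := lintegral_mono fun x => ENNReal.coe_le_coe.2 (hρC x)
      _ = C * ν univ := lintegral_const _
      _ < ∞ := ENNReal.mul_lt_top ENNReal.coe_lt_top (measure_lt_top _ _)
  have hcont : ∀ R : ℕ, Continuous fun x : Fin d → ℝ => fun j => max (-(R : ℝ)) (min (x j) R) := fun R =>
    continuous_pi fun j => continuous_const.max ((continuous_apply j).min continuous_const)
  -- setwise convergence of the truncated tilts
  have hconv : ∀ {B : Set (Fin d → ℝ)}, MeasurableSet B →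
      Tendsto (fun R : ℕ => ν.withDensity (fun x => (ρ (fun j => max (-(R : ℝ)) (min (x j) R)) : ℝ≥0∞)) B) atTop
        (𝓝 (ν.withDensity (fun x => (ρ x : ℝ≥0∞)) B)) := by
    intro B hB
    simp only [withDensity_apply _ hB]
    refine tendsto_lintegral_of_dominated_convergence (μ := ν.restrict B) (fun _ => (C : ℝ≥0∞))
      (fun R => (ENNReal.continuous_coe.comp (hρc.comp (hcont R))).measurable)
      (fun R => Eventually.of_forall fun x => ENNReal.coe_le_coe.2 (hρC _))
      (by rw [lintegral_const]; exact ENNReal.mul_ne_top ENNReal.coe_ne_top (measure_ne_top _ _))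
      (Eventually.of_forall fun x => ?_)
    exact (ENNReal.continuous_coe.tendsto _).comp ((hρc.tendsto x).comp (tendsto_clamp_real x))
  refine IsBoxTP2.of_limsup_liminf (L := (atTop : Filter ℕ))
    (μs := fun R : ℕ => ν.withDensity fun x => (ρ (fun j => max (-(R : ℝ)) (min (x j) R)) : ℝ≥0∞))
    (Eventually.of_forall fun R => hν.withDensity_clamp_real ν hρc hρ R) (fun _ => id) (fun _ => id)
    (fun _ _ _ => rfl) (fun _ _ _ => rfl) (fun _ _ _ => rfl) (fun _ _ _ => rfl)
    (fun R a b => ((hconv measurableSet_Icc).liminf_eq).symm.le)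
    (fun R a b => (hconv measurableSet_Icc).limsup_eq.le) (fun a b => tendsto_const_nhds)

/-- **Gibbs modifications on `ℝ^d`**: for a finite box-TP₂ law `ν` on `ℝ^d` and `H` continuous, submodular
(`H (x ⊓ y) + H (x ⊔ y) ≤ H x + H y`) and bounded below, `e^{−H} · ν` is box-TP₂ — hence (`SahiBoxTP2Real.lean`)
Sahi-positive of order `n` on bounded measurable monotone families given `L(d,n)`, FKG unconditionally.
[this work] -/
theorem IsBoxTP2.withDensity_exp_of_submodular_real (ν : Measure (Fin d → ℝ)) [IsFiniteMeasure ν]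
    (hν : IsBoxTP2 ν) {H : (Fin d → ℝ) → ℝ} (hHc : Continuous H) {m : ℝ} (hHm : ∀ x, m ≤ H x)
    (hH : ∀ x y, H (x ⊓ y) + H (x ⊔ y) ≤ H x + H y) :
    IsBoxTP2 (ν.withDensity fun x => ENNReal.ofReal (Real.exp (-H x))) :=
  hν.withDensity_of_continuous_real ν (ρ := fun x => Real.toNNReal (Real.exp (-H x)))
    (continuous_real_toNNReal.comp (Real.continuous_exp.comp hHc.neg)) (C := Real.toNNReal (Real.exp (-m)))
    (fun x => Real.toNNReal_le_toNNReal (Real.exp_le_exp.2 (by linarith [hHm x]))) fun x y => by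
      rw [← Real.toNNReal_mul (Real.exp_pos _).le, ← Real.toNNReal_mul (Real.exp_pos _).le, ← Real.exp_add,
        ← Real.exp_add]
      exact Real.toNNReal_le_toNNReal (Real.exp_le_exp.2 (by linarith [hH x y]))

/-! ### Integrable (possibly unbounded) tilts -/

/-- The cubes `[−R,R]^d` exhaust `ℝ^d`. [folklore] -/
theorem iUnion_Icc_neg_nat_eq_univ :
    ⋃ R : ℕ, Icc (fun _ : Fin d => -(R : ℝ)) (fun _ => (R : ℝ)) = univ := by
  refine eq_univ_of_forall fun x => mem_iUnion.2 ?_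
  obtain ⟨R, hR⟩ := exists_nat_ge (∑ j, |x j|)
  have hj : ∀ j, |x j| ≤ R := fun j =>
    (Finset.single_le_sum (fun j _ => abs_nonneg (x j)) (Finset.mem_univ j)).trans hR
  exact ⟨R, fun j => neg_le_of_abs_le (hj j), fun j => le_of_abs_le (hj j)⟩

/-- The cubes `[−R,R]^d` increase with `R`. [folklore] -/
theorem monotone_Icc_neg_nat : Monotone fun R : ℕ => Icc (fun _ : Fin d => -(R : ℝ)) (fun _ => (R : ℝ)) :=
  fun _ _ h => Icc_subset_Icc (fun _ => neg_le_neg (Nat.cast_le.2 h)) fun _ => Nat.cast_le.2 h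

/-- **Box-TP₂ on `ℝ^d` is preserved by INTEGRABLE continuous log-supermodular tilts** (unbounded densities such as
`e^{J Σ x_i x_j}` allowed): for a finite box-TP₂ measure `ν` on `ℝ^d` and `ρ : ℝ^d → ℝ≥0` continuous with
`ρ x · ρ y ≤ ρ (x ⊓ y) · ρ (x ⊔ y)` and `∫ ρ dν < ∞`, the tilted measure `ρ · ν` is box-TP₂.  (Restrict `ν` to the
cube `[−R,R]^d` — box-TP₂, `IsBoxTP2.restrict_Icc` — where `ρ` agrees with its clamped version; the truncated tilts
increase setwise to `ρ · ν`.) [this work] -/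
theorem IsBoxTP2.withDensity_of_continuous_real_of_lintegral_ne_top (ν : Measure (Fin d → ℝ)) [IsFiniteMeasure ν]
    (hν : IsBoxTP2 ν) {ρ : (Fin d → ℝ) → ℝ≥0} (hρc : Continuous ρ) (hρi : ∫⁻ x, (ρ x : ℝ≥0∞) ∂ν ≠ ∞)
    (hρ : ∀ x y, ρ x * ρ y ≤ ρ (x ⊓ y) * ρ (x ⊔ y)) : IsBoxTP2 (ν.withDensity fun x => (ρ x : ℝ≥0∞)) := by
  haveI : IsFiniteMeasure (ν.withDensity fun x => (ρ x : ℝ≥0∞)) := isFiniteMeasure_withDensity hρi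
  -- the truncated tilts `ρ · ν|_{[−R,R]^d}` are box-TP₂
  have htrunc : ∀ R : ℕ,
      IsBoxTP2 ((ν.restrict (Icc (fun _ : Fin d => -(R : ℝ)) (fun _ => (R : ℝ)))).withDensity
        fun x => (ρ x : ℝ≥0∞)) := by
    intro R
    have hae : (fun x : Fin d → ℝ => (ρ x : ℝ≥0∞)) =ᵐ[ν.restrict (Icc (fun _ : Fin d => -(R : ℝ)) (fun _ => (R : ℝ)))]
        fun x => (ρ (fun j => max (-(R : ℝ)) (min (x j) R)) : ℝ≥0∞) := by
      filter_upwards [ae_restrict_mem measurableSet_Icc] with x hx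
      have e : (fun j => max (-(R : ℝ)) (min (x j) R)) = x := by
        funext j
        rw [min_eq_left (hx.2 j), max_eq_right (hx.1 j)]
      rw [e]
    rw [withDensity_congr_ae hae]
    exact (hν.restrict_Icc _ _).withDensity_clamp_real _ hρc hρ R
  -- setwise convergence: `(ρ ν|_{K_R})(B) = (ρ ν)(B ∩ K_R) ↑ (ρ ν)(B)`
  have hconv : ∀ {B : Set (Fin d → ℝ)}, MeasurableSet B →
      Tendsto (fun R : ℕ => ((ν.restrict (Icc (fun _ : Fin d => -(R : ℝ)) (fun _ => (R : ℝ)))).withDensity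
        fun x => (ρ x : ℝ≥0∞)) B) atTop (𝓝 ((ν.withDensity fun x => (ρ x : ℝ≥0∞)) B)) := by
    intro B hB
    have e : ∀ R : ℕ, ((ν.restrict (Icc (fun _ : Fin d => -(R : ℝ)) (fun _ => (R : ℝ)))).withDensity
        fun x => (ρ x : ℝ≥0∞)) B =
        (ν.withDensity fun x => (ρ x : ℝ≥0∞)) (B ∩ Icc (fun _ : Fin d => -(R : ℝ)) (fun _ => (R : ℝ))) := by
      intro R
      rw [withDensity_apply _ hB, withDensity_apply _ (hB.inter measurableSet_Icc), Measure.restrict_restrict hB]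
    simp only [e]
    have hU : (⋃ R : ℕ, B ∩ Icc (fun _ : Fin d => -(R : ℝ)) (fun _ => (R : ℝ))) = B := by
      rw [← inter_iUnion, iUnion_Icc_neg_nat_eq_univ, inter_univ]
    have h := tendsto_measure_iUnion_atTop (μ := ν.withDensity fun x => (ρ x : ℝ≥0∞))
      (fun R R' hRR' => inter_subset_inter_right B (monotone_Icc_neg_nat hRR'))
    rw [hU] at h
    exact h
  refine IsBoxTP2.of_limsup_liminf (L := (atTop : Filter ℕ))
    (μs := fun R : ℕ => (ν.restrict (Icc (fun _ : Fin d => -(R : ℝ)) (fun _ => (R : ℝ)))).withDensity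
      fun x => (ρ x : ℝ≥0∞))
    (Eventually.of_forall htrunc) (fun _ => id) (fun _ => id) (fun _ _ _ => rfl) (fun _ _ _ => rfl)
    (fun _ _ _ => rfl) (fun _ _ _ => rfl) (fun R a b => ((hconv measurableSet_Icc).liminf_eq).symm.le)
    (fun R a b => (hconv measurableSet_Icc).limsup_eq.le) (fun a b => tendsto_const_nhds)

/-- **Gibbs modifications on `ℝ^d` with integrable Boltzmann factor**: `e^{−H} ν` is box-TP₂ for `ν` finite box-TP₂,
`H` continuous submodular and `∫ e^{−H} dν < ∞` (no lower bound on `H` needed). [this work] -/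
theorem IsBoxTP2.withDensity_exp_of_submodular_real_of_lintegral_ne_top (ν : Measure (Fin d → ℝ))
    [IsFiniteMeasure ν] (hν : IsBoxTP2 ν) {H : (Fin d → ℝ) → ℝ} (hHc : Continuous H)
    (hHi : ∫⁻ x, ENNReal.ofReal (Real.exp (-H x)) ∂ν ≠ ∞) (hH : ∀ x y, H (x ⊓ y) + H (x ⊔ y) ≤ H x + H y) :
    IsBoxTP2 (ν.withDensity fun x => ENNReal.ofReal (Real.exp (-H x))) :=
  hν.withDensity_of_continuous_real_of_lintegral_ne_top ν (ρ := fun x => Real.toNNReal (Real.exp (-H x)))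
    (continuous_real_toNNReal.comp (Real.continuous_exp.comp hHc.neg)) hHi fun x y => by
      rw [← Real.toNNReal_mul (Real.exp_pos _).le, ← Real.toNNReal_mul (Real.exp_pos _).le, ← Real.exp_add,
        ← Real.exp_add]
      exact Real.toNNReal_le_toNNReal (Real.exp_le_exp.2 (by linarith [hH x y]))

end Summit.CriticalPhenomena.PercolationContinuityZ3.Theorems.SahiBoxTP2
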